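import Literature.GroupTheory.CombinatorialGroupTheory.CyclicBlockInterchangeReduction
import Literature.GroupTheory.CombinatorialGroupTheory.FourPartitionGadget
import Literature.Computability.Complexity.FourPartitionOfThreeDM
import Literature.Computability.Complexity.ThreeDMVerifier
import Literature.Computability.Complexity.ThreeDMMachine
import Literature.Computability.Complexity.OneInThreeSATMachine
import HarnessLib

/-!
# 3DM `≤ₚ` CBI-`F₄`: the reduction machine (Garey–Johnson Thm. 4.3 + Heuer §4.1)

The Karp reduction from 3-DIMENSIONAL MATCHING (`THREEDM`, instances `⟨q, U ⊆ Fin q³⟩` coded as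
`⟨bin q, characteristic vector⟩`) to CBI over four letters (`cbiLanguage 4` of
`CyclicBlockInterchangeReduction.lean`): on a well-formed code whose triples cover every value of
the first coordinate, list the triples `T` in the order of their bits, form the 4-PARTITION
instance `(GJ4P.sizes T, B = 40 r⁴ + 15)` of [GareyJohnson1979, Thm. 4.3]
(`FourPartitionOfThreeDM.lean`) in unary, and emit the CBI-`F₄` instance
`(v, w, 4|T|)` of Heuer's gadget [Heuer2020, §4.1] (`FourPartitionGadget.lean`,
`v = a^{n+1} Π(b c^{aᵢ} d) b`, `w = (a c^B d⁴)^n a b^{4n+1}`); anything else goes to a fixed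
no-instance. Everything is assembled in the tree's algebra of `FP` string functions:

* `TDMCBI.powB s` (`u ↦ s^{|u|}`), the context record `TDMCBI.ctxF` (`x` with the unary yardsticks
  `1^q, 1^{q²}, 1^r, 1^{r²}, 1^{r³}, 1^{r⁴}`, `r = 32q`), coordinates of a bit position by `divModFn`,
  first-occurrence flags and the coverage test by `allIdxFn`, the unary sizes (`umulFn`, `dropFn`),
  the item words and the four concatenation loops;
* `TDMCBI.redFn ∈ FP`, its value on well-formed covered codes (`redFn_code`), and
  **`THREEDM_karpReducible_cbiLanguage_four : THREEDM ≤ₚ cbiLanguage 4`**;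
* `isNPHard_cbiLanguage_four` (from the tree's `THREEDM` hardness) and, with
  `CyclicBlockInterchangeBinary.lean`, the named fact's discharge is assembled in
  `CommutatorLengthNPProofs.lean`.

Everything here is proved; no named facts.

## References

* [GareyJohnson1979] M. R. Garey, D. S. Johnson, *Computers and Intractability*, 1979, Thm. 4.3.
* [Heuer2020] N. Heuer, *Computing commutator length is hard*, arXiv:2001.10230, §4.1, Thm. 3.
* [AroraBarakCC2009] S. Arora, B. Barak, *Computational Complexity*, CUP 2009, §1.3 (closure of
  polynomial time under composition and bounded loops).
-/

noncomputable section

namespace Literature.GroupTheory.CombinatorialGroupTheory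

open _root_.Computability Literature.Computability.Complexity Literature.Computability.Complexity.Brick
  Literature.Computability.Complexity.HashBricks Literature.Computability.Complexity.Plumb
  Literature.Computability.Complexity.OracleCompose Polynomial
open scoped Literature.Computability.Complexity.Notation

namespace TDMCBI

/-! ### Block powers `s^{|u|}` -/

/-- A constant concatenation is the flattened replicate. [folklore] -/
theorem ccat_const (c : List Bool) : ∀ K : ℕ, ccat (fun _ => c) K = (List.replicate K c).flatten
  | 0 => rfl
  | K + 1 => by rw [ccat_succ, ccat_const c K, List.replicate_succ', List.flatten_append, List.flatten_singleton]

/-- **`powB s u = s^{|u|}`** (a concatenation loop with constant pieces). [cite: AroraBarakCC2009, §1.3 (bounded loops)] -/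
def powB (s : List Bool) : List Bool → List Bool :=
  sndPow 2 ∘ foldLoop appF (fun _ => s) X ∘ fanoutFn id (fanoutFn lenBinF fun _ => boolPair [] [])

/-- `powB s ∈ FP`. [cite: AroraBarakCC2009, §1.3] -/
theorem powB_mem_FP (s : List Bool) : powB s ∈ FP :=
  comp_mem_FP (sndPow_mem_FP 2) (comp_mem_FP
    (foldLoop_mem_FP (C := s.length) appF_mem_FP length_appF_le (const_mem_FP _)
      (fun _ => Nat.le_mul_of_pos_right _ (Nat.succ_pos _)) X)
    (fanoutFn_mem_FP id_mem_FP (fanoutFn_mem_FP lenBinF_mem_FP (const_mem_FP _))))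

/-- **Value of `powB`.** [folklore] -/
@[simp] theorem powB_apply (s u : List Bool) : powB s u = (List.replicate u.length s).flatten := by
  have hinit : fanoutFn id (fanoutFn lenBinF fun _ => boolPair [] []) u =
      boolPair u (boolPair (encodeNat u.length) (boolPair (ones 0) [])) := by simp [ones]
  rw [powB, Function.comp_apply, Function.comp_apply, hinit, foldLoop_apply appF _ (by simp) 0 [],
    sndPow_succ_boolPair, sndPow_succ_boolPair, sndPow_zero_boolPair, foldAcc_appF, List.nil_append, ccat_const]

/-! ### Unary arithmetic helpers -/

/-- Unary product of two fields: `1^{|f z| · |g z|}`. [folklore] -/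
def umul2 (f g : List Bool → List Bool) : List Bool → List Bool := umulFn ∘ fanoutFn f g

/-- `umul2 f g ∈ FP`. [folklore] -/
theorem umul2_mem_FP {f g : List Bool → List Bool} (hf : f ∈ FP) (hg : g ∈ FP) : umul2 f g ∈ FP :=
  comp_mem_FP umulFn_mem_FP (fanoutFn_mem_FP hf hg)

/-- Value of `umul2`. [folklore] -/
@[simp] theorem umul2_apply (f g : List Bool → List Bool) (z : List Bool) : umul2 f g z = ones ((f z).length * (g z).length) := by
  simp [umul2, umulFn_apply]

/-- Concatenation of two fields. [folklore] -/
def app2 (f g : List Bool → List Bool) : List Bool → List Bool := appF ∘ fanoutFn f g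

/-- `app2 f g ∈ FP`. [folklore] -/
theorem app2_mem_FP {f g : List Bool → List Bool} (hf : f ∈ FP) (hg : g ∈ FP) : app2 f g ∈ FP :=
  comp_mem_FP appF_mem_FP (fanoutFn_mem_FP hf hg)

/-- Value of `app2`. [folklore] -/
@[simp] theorem app2_apply (f g : List Bool → List Bool) (z : List Bool) : app2 f g z = f z ++ g z := by
  simp [app2]

/-- Unary difference of two fields: `1^{|g z| − |f z|}` when `g z` is unary. [folklore] -/
def usub (g f : List Bool → List Bool) : List Bool → List Bool := dropFn ∘ fanoutFn f g

/-- `usub g f ∈ FP`. [folklore] -/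
theorem usub_mem_FP {f g : List Bool → List Bool} (hg : g ∈ FP) (hf : f ∈ FP) : usub g f ∈ FP :=
  comp_mem_FP dropFn_mem_FP (fanoutFn_mem_FP hf hg)

/-- Value of `usub`. [folklore] -/
@[simp] theorem usub_apply (g f : List Bool → List Bool) (z : List Bool) : usub g f z = (g z).drop (f z).length := by
  simp [usub]

/-- `ones` dropped. [folklore] -/
theorem drop_ones' (m n : ℕ) : (ones n).drop m = ones (n - m) := List.drop_replicate ..

/-- `ones` appended. [folklore] -/
theorem ones_append (m n : ℕ) : ones m ++ ones n = ones (m + n) := (List.replicate_add ..).symm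

/-- Length of `ones`. [folklore] -/
@[simp] theorem length_ones (n : ℕ) : (ones n).length = n := List.length_replicate ..

/-! ### The context record -/

/-- On `x`: `1^q`, `q = ⟦fstF x⟧` capped by `|x|`. [folklore] -/
def qF : List Bool → List Bool := binToUnaryFn ∘ fanoutFn id fstF

/-- **The context record** `y = ⟨x, ⟨1^q, ⟨1^{q²}, ⟨1^r, ⟨1^{r²}, ⟨1^{r³}, 1^{r⁴}⟩⟩⟩⟩⟩⟩`. [folklore] -/
def ctxF : List Bool → List Bool :=
  fanoutFn id (fanoutFn qF (fanoutFn (umul2 qF qF) (fanoutFn (umul2 (fun _ => ones 32) qF)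
    (fanoutFn (umul2 (umul2 (fun _ => ones 32) qF) (umul2 (fun _ => ones 32) qF))
      (fanoutFn (umul2 (umul2 (umul2 (fun _ => ones 32) qF) (umul2 (fun _ => ones 32) qF)) (umul2 (fun _ => ones 32) qF))
        (umul2 (umul2 (umul2 (fun _ => ones 32) qF) (umul2 (fun _ => ones 32) qF))
          (umul2 (umul2 (fun _ => ones 32) qF) (umul2 (fun _ => ones 32) qF))))))))

/-- `qF ∈ FP`. [folklore] -/
theorem qF_mem_FP : qF ∈ FP := comp_mem_FP binToUnaryFn_mem_FP (fanoutFn_mem_FP id_mem_FP fstF_mem_FP)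

/-- `ctxF ∈ FP`. [cite: AroraBarakCC2009, §1.3] -/
theorem ctxF_mem_FP : ctxF ∈ FP := by
  have hr : umul2 (fun _ => ones 32) qF ∈ FP := umul2_mem_FP (const_mem_FP _) qF_mem_FP
  have hr2 : umul2 (umul2 (fun _ => ones 32) qF) (umul2 (fun _ => ones 32) qF) ∈ FP := umul2_mem_FP hr hr
  exact fanoutFn_mem_FP id_mem_FP (fanoutFn_mem_FP qF_mem_FP (fanoutFn_mem_FP (umul2_mem_FP qF_mem_FP qF_mem_FP)
    (fanoutFn_mem_FP hr (fanoutFn_mem_FP hr2 (fanoutFn_mem_FP (umul2_mem_FP hr2 hr) (umul2_mem_FP hr2 hr2))))))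

/-- The semantic context record of `(q, v)`. [folklore] -/
def yCtx (q : ℕ) (v : List Bool) : List Bool :=
  boolPair (boolPair (encodeNat q) v) (boolPair (ones q) (boolPair (ones (q * q)) (boolPair (ones (GJ4P.rr q))
    (boolPair (ones (GJ4P.rr q ^ 2)) (boolPair (ones (GJ4P.rr q ^ 3)) (ones (GJ4P.rr q ^ 4)))))))

/-- `q ≤ |⟨bin q, v⟩|` when `|v| = q³`. [folklore] -/
theorem q_le_length_code (q : ℕ) (v : List Bool) (hv : v.length = q * (q * q)) : q ≤ (boolPair (encodeNat q) v).length := by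
  rw [length_boolPair, hv]
  have := ThreeDMNP.le_cube_add_two q
  omega

/-- Value of `qF` on a code. [folklore] -/
theorem qF_code (q : ℕ) (v : List Bool) (hv : v.length = q * (q * q)) : qF (boolPair (encodeNat q) v) = ones q := by
  rw [qF, Function.comp_apply, fanoutFn_apply, id, fstF_boolPair, binToUnaryFn_boolPair, bitsToNat_encodeNat,
    Nat.min_eq_left (q_le_length_code q v hv)]

/-- **Value of the context record on a code.** [folklore] -/
theorem ctxF_code (q : ℕ) (v : List Bool) (hv : v.length = q * (q * q)) : ctxF (boolPair (encodeNat q) v) = yCtx q v := by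
  simp only [ctxF, fanoutFn_apply, id, umul2_apply, qF_code q v hv, yCtx]
  simp only [ones, List.length_replicate]
  congr 2
  all_goals (simp only [GJ4P.rr]; ring_nf)

/-! ### Fields of the context record -/

/-- On `y`: the bit vector `v`. [folklore] -/
def vY : List Bool → List Bool := sndF ∘ fstF
/-- On `y`: `1^q`. [folklore] -/
def qY : List Bool → List Bool := fstF ∘ sndF
/-- On `y`: `1^{q²}`. [folklore] -/
def q2Y : List Bool → List Bool := fstF ∘ sndF ∘ sndF
/-- On `y`: `1^{q³}`. [folklore] -/
def q3Y : List Bool → List Bool := umul2 qY q2Y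
/-- On `y`: `1^{r^{c+1}}` (`c = 0, 1, 2`) and `1^{r⁴}` (`c = 3`). [folklore] -/
def rPowY (c : ℕ) : List Bool → List Bool :=
  if c = 0 then fstF ∘ sndF ∘ sndF ∘ sndF else if c = 1 then fstF ∘ sndF ∘ sndF ∘ sndF ∘ sndF
  else if c = 2 then fstF ∘ sndF ∘ sndF ∘ sndF ∘ sndF ∘ sndF else sndF ∘ sndF ∘ sndF ∘ sndF ∘ sndF ∘ sndF

/-- The field accessors are in `FP`. [folklore] -/
theorem vY_mem_FP : vY ∈ FP := comp_mem_FP sndF_mem_FP fstF_mem_FP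
/-- The field accessors are in `FP`. [folklore] -/
theorem qY_mem_FP : qY ∈ FP := comp_mem_FP fstF_mem_FP sndF_mem_FP
/-- The field accessors are in `FP`. [folklore] -/
theorem q2Y_mem_FP : q2Y ∈ FP := comp_mem_FP fstF_mem_FP (comp_mem_FP sndF_mem_FP sndF_mem_FP)
/-- The field accessors are in `FP`. [folklore] -/
theorem q3Y_mem_FP : q3Y ∈ FP := umul2_mem_FP qY_mem_FP q2Y_mem_FP
/-- The field accessors are in `FP`. [folklore] -/
theorem rPowY_mem_FP (c : ℕ) : rPowY c ∈ FP := by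
  unfold rPowY
  have h5 : (sndF ∘ sndF ∘ sndF ∘ sndF ∘ sndF : List Bool → List Bool) ∈ FP :=
    comp_mem_FP sndF_mem_FP (comp_mem_FP sndF_mem_FP (comp_mem_FP sndF_mem_FP (comp_mem_FP sndF_mem_FP sndF_mem_FP)))
  split_ifs
  · exact comp_mem_FP fstF_mem_FP (comp_mem_FP sndF_mem_FP (comp_mem_FP sndF_mem_FP sndF_mem_FP))
  · exact comp_mem_FP fstF_mem_FP (comp_mem_FP sndF_mem_FP (comp_mem_FP sndF_mem_FP (comp_mem_FP sndF_mem_FP sndF_mem_FP)))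
  · exact comp_mem_FP fstF_mem_FP h5
  · exact comp_mem_FP sndF_mem_FP h5

section FieldValues

variable (q : ℕ) (v : List Bool)

/-- Field values on the semantic record. [folklore] -/
@[simp] theorem vY_yCtx : vY (yCtx q v) = v := by simp [vY, yCtx]
/-- Field values on the semantic record. [folklore] -/
@[simp] theorem qY_yCtx : qY (yCtx q v) = ones q := by simp [qY, yCtx]
/-- Field values on the semantic record. [folklore] -/
@[simp] theorem q2Y_yCtx : q2Y (yCtx q v) = ones (q * q) := by simp [q2Y, yCtx]
/-- Field values on the semantic record. [folklore] -/
@[simp] theorem q3Y_yCtx : q3Y (yCtx q v) = ones (q * (q * q)) := by simp [q3Y, ones]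
/-- Field values on the semantic record. [folklore] -/
@[simp] theorem rPowY_yCtx (c : ℕ) (hc : c < 4) : rPowY c (yCtx q v) = ones (GJ4P.rr q ^ (c + 1)) := by
  unfold rPowY
  rcases c with _ | _ | _ | _ | c
  · simp [yCtx]
  · simp [yCtx]
  · simp [yCtx]
  · simp [yCtx]
  · omega

/-- The record is at least as long as `v`. [folklore] -/
theorem length_v_le_yCtx : v.length ≤ (yCtx q v).length := by
  simp only [yCtx, length_boolPair]; omega

/-- The record is at least as long as `r⁴`. [folklore] -/
theorem r4_le_yCtx : GJ4P.rr q ^ 4 ≤ (yCtx q v).length := by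
  simp only [yCtx, length_boolPair, ones, List.length_replicate]; omega

end FieldValues

/-! ### Coordinates of a position, the bit test -/

section Coords

variable (ya pos : List Bool → List Bool)

/-- `⟨1^{p / q²}, 1^{p % q²}⟩`. [folklore] -/
def dmA : List Bool → List Bool := divModFn ∘ fanoutFn (q2Y ∘ ya) pos
/-- `⟨1^{(p % q²)/q}, 1^{(p % q²) % q}⟩`. [folklore] -/
def dmB : List Bool → List Bool := divModFn ∘ fanoutFn (qY ∘ ya) (sndF ∘ dmA ya pos)
/-- **The `c`-coordinate of position `p`** in unary (`p = i q² + j q + k`). [folklore] -/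
def coordF (c : ℕ) : List Bool → List Bool :=
  if c = 0 then fstF ∘ dmA ya pos else if c = 1 then fstF ∘ dmB ya pos else sndF ∘ dmB ya pos

/-- **The bit of `v` at position `p`** as a one-bit test. [folklore] -/
def bitT : List Bool → List Bool := eqPairFn ∘ fanoutFn (bitAtFn ∘ fanoutFn pos (vY ∘ ya)) fun _ => [true]

variable {ya pos} (hya : ya ∈ FP) (hpos : pos ∈ FP)
include hya hpos

/-- `dmA ∈ FP`. [folklore] -/
theorem dmA_mem_FP : dmA ya pos ∈ FP := comp_mem_FP divModFn_mem_FP (fanoutFn_mem_FP (comp_mem_FP q2Y_mem_FP hya) hpos)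
/-- `dmB ∈ FP`. [folklore] -/
theorem dmB_mem_FP : dmB ya pos ∈ FP :=
  comp_mem_FP divModFn_mem_FP (fanoutFn_mem_FP (comp_mem_FP qY_mem_FP hya) (comp_mem_FP sndF_mem_FP (dmA_mem_FP hya hpos)))
/-- `coordF ∈ FP`. [folklore] -/
theorem coordF_mem_FP (c : ℕ) : coordF ya pos c ∈ FP := by
  unfold coordF; split_ifs
  · exact comp_mem_FP fstF_mem_FP (dmA_mem_FP hya hpos)
  · exact comp_mem_FP fstF_mem_FP (dmB_mem_FP hya hpos)
  · exact comp_mem_FP sndF_mem_FP (dmB_mem_FP hya hpos)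
/-- `bitT ∈ FP`. [folklore] -/
theorem bitT_mem_FP : bitT ya pos ∈ FP :=
  comp_mem_FP eqPairFn_mem_FP (fanoutFn_mem_FP (comp_mem_FP bitAtFn_mem_FP (fanoutFn_mem_FP hpos (comp_mem_FP vY_mem_FP hya)))
    (const_mem_FP _))

omit hya hpos in
/-- `bitT` is one-bit. [folklore] -/
theorem oneBit_bitT : OneBit (bitT ya pos) := oneBit_eqPairFn.comp _

/-- The `c`-coordinate of a position as a number. [folklore] -/
def coordN (q : ℕ) (c p : ℕ) : ℕ := if c = 0 then p / (q * q) else if c = 1 then p % (q * q) / q else p % (q * q) % q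

omit hya hpos in
/-- **Value of `coordF`.** [folklore] -/
theorem coordF_apply {q : ℕ} {v z : List Bool} {p : ℕ} (hy : ya z = yCtx q v) (hp : pos z = ones p) (c : ℕ) :
    coordF ya pos c z = ones (coordN q c p) := by
  have hA : dmA ya pos z = boolPair (ones (p / (q * q))) (ones (p % (q * q))) := by
    simp [dmA, hy, hp]
  have hB : dmB ya pos z = boolPair (ones (p % (q * q) / q)) (ones (p % (q * q) % q)) := by
    simp [dmB, hy, hA]
  unfold coordF coordN
  split_ifs <;> simp [hA, hB]

omit hya hpos in
/-- **Value of `bitT`.** [folklore] -/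
theorem bitT_apply {q : ℕ} {v z : List Bool} {p : ℕ} (hy : ya z = yCtx q v) (hp : pos z = ones p) :
    bitT ya pos z = [v.getD p false] := by
  rw [bitT, Function.comp_apply, fanoutFn_apply, Function.comp_apply, fanoutFn_apply, hp, Function.comp_apply, hy, vY_yCtx,
    eqPairFn_boolPair]
  by_cases h : p < v.length
  · rw [bitAtFn_boolPair_of_lt _ _ (by simpa [ones] using h), List.getD_eq_getElem _ _ h]
    simp [ones]
  · rw [bitAtFn_boolPair, List.getD_eq_default _ _ (by omega),
      show v.drop (ones p).length = [] from List.drop_eq_nil_of_le (by simp [ones]; omega)]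
    simp

omit hya hpos in
/-- Coordinates of the position of a triple are its coordinates. [cite: AroraBarakCC2009, §0.1] -/
theorem coordN_finTripleEquiv (q : ℕ) (t : Fin q × Fin q × Fin q) (c : Fin 3) :
    coordN q c.val ((finTripleEquiv q t).val) = GJ4P.coord t c := by
  rw [ThreeDMNP.finTripleEquiv_val]
  have h1 := t.1.isLt
  have h2 := t.2.1.isLt
  have h3 := t.2.2.isLt
  have hq : 0 < q := by omega
  have hqq : 0 < q * q := Nat.mul_pos hq hq
  have e : (t.1 : ℕ) * q * q + ((t.2.1 : ℕ) * q + t.2.2) = (t.1 : ℕ) * (q * q) + ((t.2.1 : ℕ) * q + t.2.2) := by ring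
  have hlt : (t.2.1 : ℕ) * q + t.2.2 < q * q := by nlinarith
  unfold coordN GJ4P.coord
  obtain rfl | rfl | rfl : c = 0 ∨ c = 1 ∨ c = 2 := by omega
  · simp only [Fin.val_zero, if_true, e]
    rw [Nat.add_comm, Nat.add_mul_div_right _ _ hqq, Nat.div_eq_of_lt hlt, Nat.zero_add]
  · simp only [Fin.val_one, one_ne_zero, if_false, if_true, e, Fin.isValue]
    rw [Nat.add_comm, Nat.add_mul_mod_self_right, Nat.mod_eq_of_lt hlt, Nat.add_comm, Nat.add_mul_div_right _ _ hq,
      Nat.div_eq_of_lt h3, Nat.zero_add]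
  · simp only [Fin.val_two, Fin.isValue, e]
    rw [if_neg (by decide), if_neg (by decide), Nat.add_comm ((t.1 : ℕ) * (q * q)), Nat.add_mul_mod_self_right,
      Nat.mod_eq_of_lt hlt, Nat.add_comm, Nat.add_mul_mod_self_right, Nat.mod_eq_of_lt h3]
    simp

end Coords

/-! ### Index loops: `∀` / `∃` over positions -/

/-- `anyIdx h c u = [∃ i < |h u|, c ⟨u, 1ⁱ⟩ = [1]]`. [cite: AroraBarakCC2009, §1.3 (bounded loops)] -/
def anyIdx (h c : List Bool → List Bool) : List Bool → List Bool := notFn (allIdxFn h (notFn c))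

/-- `anyIdx ∈ FP`. [folklore] -/
theorem anyIdx_mem_FP {h c : List Bool → List Bool} (hh : h ∈ FP) (hc : c ∈ FP) (h1 : OneBit c) : anyIdx h c ∈ FP :=
  notFn_mem_FP (allIdxFn_mem_FP hh (notFn_mem_FP hc) (oneBit_notFn h1))

/-- `anyIdx` is one-bit when the yardstick fits. [folklore] -/
theorem oneBit_anyIdx {h c : List Bool → List Bool} (h1 : OneBit c) (hu : ∀ u, (h u).length ≤ u.length) : OneBit (anyIdx h c) :=
  oneBit_notFn (oneBit_allIdxFn (oneBit_notFn h1) hu)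

/-- **Value of `anyIdx`.** [folklore] -/
theorem anyIdx_apply {h c : List Bool → List Bool} (h1 : OneBit c) {u : List Bool} (hu : (h u).length ≤ u.length) :
    anyIdx h c u = [decide (∃ i < (h u).length, c (boolPair u (ones i)) = [true])] := by
  rw [anyIdx, notFn_apply (allIdxFn_apply (oneBit_notFn h1) hu)]
  congr 1
  have hneg : ∀ i, notFn c (boolPair u (ones i)) = [true] ↔ ¬ c (boolPair u (ones i)) = [true] := fun i => by
    obtain ⟨b, hb⟩ := h1 (boolPair u (ones i))
    rw [notFn_apply hb, hb]
    cases b <;> simp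
  simp only [hneg]
  by_cases hex : ∃ i < (h u).length, c (boolPair u (ones i)) = [true]
  · rw [decide_eq_true hex]
    obtain ⟨i, hi, hci⟩ := hex
    simp only [Bool.not_eq_true', decide_eq_false_iff_not, not_forall]
    exact ⟨i, hi, not_not.2 hci⟩
  · rw [decide_eq_false hex]
    push Not at hex
    simpa using hex

/-! ### First-occurrence flags and the coverage test -/

/-- On `⟨y, 1^{p}⟩`: **position `p` is the first set position with its `c`-coordinate** (no set
position `p' < p` has the same `c`-coordinate). [cite: GareyJohnson1979, Thm. 4.3 ("z[1]")] -/
def firstT (c : ℕ) : List Bool → List Bool :=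
  allIdxFn sndF (notFn (andFn (bitT (fstF ∘ fstF) sndF)
    (eqPairFn ∘ fanoutFn (coordF (fstF ∘ fstF) sndF c) (coordF (fstF ∘ fstF) (sndF ∘ fstF) c))))

/-- `firstT ∈ FP`. [folklore] -/
theorem firstT_mem_FP (c : ℕ) : firstT c ∈ FP := by
  have hya : (fstF ∘ fstF : List Bool → List Bool) ∈ FP := comp_mem_FP fstF_mem_FP fstF_mem_FP
  refine allIdxFn_mem_FP sndF_mem_FP (notFn_mem_FP (andFn_mem_FP (bitT_mem_FP hya sndF_mem_FP)
    (comp_mem_FP eqPairFn_mem_FP (fanoutFn_mem_FP (coordF_mem_FP hya sndF_mem_FP c)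
      (coordF_mem_FP hya (comp_mem_FP sndF_mem_FP fstF_mem_FP) c))))) (oneBit_notFn (oneBit_andFn oneBit_bitT
        (oneBit_eqPairFn.comp _)))

/-- `|sndF u| ≤ |u|`. [folklore] -/
theorem length_sndF_le' (u : List Bool) : (sndF u).length ≤ u.length := by
  have := length_fstF_sndF_le u; omega

/-- `|fstF u| ≤ |u|`. [folklore] -/
theorem length_fstF_le' (u : List Bool) : (fstF u).length ≤ u.length := by
  have := length_fstF_sndF_le u; omega

/-- `firstT` is one-bit. [folklore] -/
theorem oneBit_firstT (c : ℕ) : OneBit (firstT c) :=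
  oneBit_allIdxFn (oneBit_notFn (oneBit_andFn oneBit_bitT (oneBit_eqPairFn.comp _))) length_sndF_le'

/-- The property tested by `firstT`. [folklore] -/
def FirstN (q : ℕ) (v : List Bool) (c p : ℕ) : Prop := ∀ p', p' < p → ¬(v.getD p' false = true ∧ coordN q c p' = coordN q c p)

/-- `FirstN` is decidable. [folklore] -/
instance (q : ℕ) (v : List Bool) (c p : ℕ) : Decidable (FirstN q v c p) := by unfold FirstN; infer_instance

/-- **Value of `firstT`.** [folklore] -/
theorem firstT_apply (q : ℕ) (v : List Bool) (c p : ℕ) : firstT c (boolPair (yCtx q v) (ones p)) = [decide (FirstN q v c p)] := by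
  rw [firstT, allIdxFn_apply (oneBit_notFn (oneBit_andFn oneBit_bitT (oneBit_eqPairFn.comp _))) (length_sndF_le' _),
    sndF_boolPair, length_ones]
  congr 1
  apply Bool.decide_congr
  unfold FirstN
  refine forall_congr' fun p' => imp_congr_right fun _ => ?_
  have hb : bitT (fstF ∘ fstF) sndF (boolPair (boolPair (yCtx q v) (ones p)) (ones p')) = [v.getD p' false] :=
    bitT_apply (q := q) (v := v) (p := p') (by simp) (by simp)
  have hc1 : coordF (fstF ∘ fstF) sndF c (boolPair (boolPair (yCtx q v) (ones p)) (ones p')) = ones (coordN q c p') :=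
    coordF_apply (q := q) (v := v) (p := p') (by simp) (by simp) c
  have hc2 : coordF (fstF ∘ fstF) (sndF ∘ fstF) c (boolPair (boolPair (yCtx q v) (ones p)) (ones p')) =
      ones (coordN q c p) := coordF_apply (q := q) (v := v) (p := p) (by simp) (by simp) c
  have he : (eqPairFn ∘ fanoutFn (coordF (fstF ∘ fstF) sndF c) (coordF (fstF ∘ fstF) (sndF ∘ fstF) c))
      (boolPair (boolPair (yCtx q v) (ones p)) (ones p')) = [decide (coordN q c p' = coordN q c p)] := by
    rw [Function.comp_apply, fanoutFn_apply, hc1, hc2, eqPairFn_boolPair]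
    simp
  rw [notFn_apply (andFn_apply hb he)]
  cases v.getD p' false <;> simp

/-- On `y`: **every `w`-value occurs in a set triple** (`∀ i < q, ∃ p < q², v[i q² + p]`). [cite: GareyJohnson1979, Thm. 4.3] -/
def covT : List Bool → List Bool :=
  allIdxFn qY (anyIdx (q2Y ∘ fstF) (bitT (fstF ∘ fstF) (app2 (umul2 (sndF ∘ fstF) (q2Y ∘ fstF ∘ fstF)) sndF)))

/-- `covT ∈ FP`. [folklore] -/
theorem covT_mem_FP : covT ∈ FP := by
  have hya : (fstF ∘ fstF : List Bool → List Bool) ∈ FP := comp_mem_FP fstF_mem_FP fstF_mem_FP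
  have hpos : app2 (umul2 (sndF ∘ fstF) (q2Y ∘ fstF ∘ fstF)) sndF ∈ FP :=
    app2_mem_FP (umul2_mem_FP (comp_mem_FP sndF_mem_FP fstF_mem_FP) (comp_mem_FP q2Y_mem_FP hya)) sndF_mem_FP
  exact allIdxFn_mem_FP qY_mem_FP (anyIdx_mem_FP (comp_mem_FP q2Y_mem_FP fstF_mem_FP) (bitT_mem_FP hya hpos) oneBit_bitT)
    (oneBit_anyIdx oneBit_bitT fun u => (length_fstF_le' _).trans' (by
      simp only [q2Y, Function.comp_apply]; exact (length_fstF_le' _).trans ((length_sndF_le' _).trans (length_sndF_le' _))))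

/-- The property tested by `covT`. [folklore] -/
def Covered (q : ℕ) (v : List Bool) : Prop := ∀ i, i < q → ∃ p, p < q * q ∧ v.getD (i * (q * q) + p) false = true

/-- `Covered` is decidable. [folklore] -/
instance (q : ℕ) (v : List Bool) : Decidable (Covered q v) := by unfold Covered; infer_instance

/-- **Value of `covT`.** [folklore] -/
theorem covT_apply (q : ℕ) (v : List Bool) : covT (yCtx q v) = [decide (Covered q v)] := by
  have hq2 : ∀ u : List Bool, ((q2Y ∘ fstF) u).length ≤ u.length := fun u => by
    simp only [q2Y, Function.comp_apply]
    exact (length_fstF_le' _).trans ((length_sndF_le' _).trans ((length_sndF_le' _).trans (length_fstF_le' _)))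
  have hqy : (qY (yCtx q v)).length ≤ (yCtx q v).length := (length_fstF_le' _).trans (length_sndF_le' _)
  rw [covT, allIdxFn_apply (oneBit_anyIdx oneBit_bitT hq2) hqy, qY_yCtx, length_ones]
  congr 1
  apply Bool.decide_congr
  unfold Covered
  refine forall_congr' fun i => imp_congr_right fun _ => ?_
  rw [anyIdx_apply oneBit_bitT (hq2 _)]
  simp only [Function.comp_apply, fstF_boolPair, q2Y_yCtx, length_ones, List.cons.injEq, and_true, decide_eq_true_eq]
  refine exists_congr fun p => and_congr_right fun _ => ?_
  have hpos : app2 (umul2 (sndF ∘ fstF) (q2Y ∘ fstF ∘ fstF)) sndF (boolPair (boolPair (yCtx q v) (ones i)) (ones p)) =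
      ones (i * (q * q) + p) := by
    simp only [app2_apply, umul2_apply, Function.comp_apply, fstF_boolPair, sndF_boolPair, q2Y_yCtx, length_ones, ones_append]
  rw [bitT_apply (q := q) (v := v) (p := i * (q * q) + p) (by simp) hpos]
  simp

/-! ### The unary sizes at a set position -/

section Sizes

/-- On `⟨y, 1^p⟩`: `1^{coord_c(p) · r^{c+1}}` (`GJ4P.low`). [cite: GareyJohnson1979, Thm. 4.3] -/
def lowT (c : ℕ) : List Bool → List Bool := umul2 (coordF fstF sndF c) (rPowY c ∘ fstF)

/-- On `⟨y, 1^p⟩`: the three low parts together. [folklore] -/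
def lowSum : List Bool → List Bool := app2 (lowT 0) (app2 (lowT 1) (lowT 2))

/-- On `⟨y, 1^p⟩`: `1^{m r⁴}`. [folklore] -/
def cR4 (m : ℕ) : List Bool → List Bool := umul2 (fun _ => ones m) (rPowY 3 ∘ fstF)

/-- On `⟨y, 1^p⟩`: the `r⁴`-coefficient of the occurrence element of kind `c` (`GJ4P.coef`) times `r⁴`. [cite: GareyJohnson1979, Thm. 4.3] -/
def coefT (c : ℕ) : List Bool → List Bool := iteFn (firstT c) (cR4 10) (cR4 (if c = 2 then 8 else 11))

/-- On `⟨y, 1^p⟩`: **the size of `u_l`** in unary, `1^{10r⁴ − (ir + jr² + kr³) + 8}`. [cite: GareyJohnson1979, Thm. 4.3] -/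
def sizeU : List Bool → List Bool := app2 (usub (cR4 10) lowSum) fun _ => ones 8

/-- The residue of the occurrence element of kind `c`. [folklore] -/
def residN (c : ℕ) : ℕ := if c = 0 then 1 else if c = 1 then 2 else 4

/-- On `⟨y, 1^p⟩`: **the size of the occurrence element of kind `c`** in unary. [cite: GareyJohnson1979, Thm. 4.3] -/
def sizeO (c : ℕ) : List Bool → List Bool := app2 (coefT c) (app2 (lowT c) fun _ => ones (residN c))

/-- `lowT ∈ FP`. [folklore] -/
theorem lowT_mem_FP (c : ℕ) : lowT c ∈ FP :=
  umul2_mem_FP (coordF_mem_FP fstF_mem_FP sndF_mem_FP c) (comp_mem_FP (rPowY_mem_FP c) fstF_mem_FP)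
/-- `lowSum ∈ FP`. [folklore] -/
theorem lowSum_mem_FP : lowSum ∈ FP := app2_mem_FP (lowT_mem_FP 0) (app2_mem_FP (lowT_mem_FP 1) (lowT_mem_FP 2))
/-- `cR4 ∈ FP`. [folklore] -/
theorem cR4_mem_FP (m : ℕ) : cR4 m ∈ FP := umul2_mem_FP (const_mem_FP _) (comp_mem_FP (rPowY_mem_FP 3) fstF_mem_FP)
/-- `coefT ∈ FP`. [folklore] -/
theorem coefT_mem_FP (c : ℕ) : coefT c ∈ FP := iteFn_mem_FP (firstT_mem_FP c) (cR4_mem_FP _) (cR4_mem_FP _)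
/-- `sizeU ∈ FP`. [folklore] -/
theorem sizeU_mem_FP : sizeU ∈ FP := app2_mem_FP (usub_mem_FP (cR4_mem_FP 10) lowSum_mem_FP) (const_mem_FP _)
/-- `sizeO ∈ FP`. [folklore] -/
theorem sizeO_mem_FP (c : ℕ) : sizeO c ∈ FP := app2_mem_FP (coefT_mem_FP c) (app2_mem_FP (lowT_mem_FP c) (const_mem_FP _))

end Sizes

/-! ### Letter codes over `F₄`, items, pieces, loops -/

section Pieces

/-- The `F₄` letter codes of `a, b, c, d`. [folklore] -/
def L4 (i : Fin 4) : List Bool := clLetterCode 4 (i, true)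

/-- On a record: **the code of the item word `b c^{|g|} d`** for a unary size field `g`. [cite: Heuer2020, §4.1] -/
def itemOf (g : List Bool → List Bool) : List Bool → List Bool :=
  app2 (fun _ => L4 1) (app2 (powB (L4 2) ∘ g) fun _ => L4 3)

/-- On `⟨y, 1^p⟩`: the codes of the four items of the triple at position `p`. [cite: GareyJohnson1979, Thm. 4.3] -/
def itemsZ : List Bool → List Bool :=
  app2 (itemOf sizeU) (app2 (itemOf (sizeO 0)) (app2 (itemOf (sizeO 1)) (itemOf (sizeO 2))))

/-- On `⟨y, 1^p⟩`: the pieces of the four loops (nothing at unset positions). [folklore] -/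
def pieceV : List Bool → List Bool := iteFn (bitT fstF sndF) itemsZ fun _ => []
/-- On `⟨y, 1^p⟩`: one `a` per set position. [folklore] -/
def pieceA : List Bool → List Bool := iteFn (bitT fstF sndF) (fun _ => L4 0) fun _ => []
/-- On `y`: `1^B`, `B = 40 r⁴ + 15`. [folklore] -/
def bY : List Bool → List Bool := app2 (umul2 (fun _ => ones 40) (rPowY 3)) fun _ => ones 15
/-- On `y`: the code of a group word `a c^B d⁴`. [cite: Heuer2020, §4.1] -/
def groupCode : List Bool → List Bool :=
  app2 (fun _ => L4 0) (app2 (powB (L4 2) ∘ bY) fun _ => L4 3 ++ L4 3 ++ L4 3 ++ L4 3)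
/-- On `⟨y, 1^p⟩`: one group word per set position. [folklore] -/
def pieceG : List Bool → List Bool := iteFn (bitT fstF sndF) (groupCode ∘ fstF) fun _ => []
/-- On `⟨y, 1^p⟩`: four `b`'s per set position. [folklore] -/
def pieceB : List Bool → List Bool := iteFn (bitT fstF sndF) (fun _ => L4 1 ++ L4 1 ++ L4 1 ++ L4 1) fun _ => []
/-- On `⟨y, 1^p⟩`: `1⁴` per set position (the threshold `4n`). [folklore] -/
def pieceK : List Bool → List Bool := iteFn (bitT fstF sndF) (fun _ => ones 4) fun _ => []

/-- On `y`: **the concatenation loop over the `q³` positions** with clipped pieces. [cite: AroraBarakCC2009, §1.3 (bounded loops)] -/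
def loopZ (C : ℕ) (f : List Bool → List Bool) : List Bool → List Bool :=
  sndPow 2 ∘ foldLoop appF (clipF C f) X ∘ fanoutFn id (fanoutFn (lenBinF ∘ q3Y) fun _ => boolPair [] [])

/-- On `y`: the code of `v = a^{n+1} Π(b c^{aᵢ} d) b`. [cite: Heuer2020, §4.1] -/
def vCodeF : List Bool → List Bool := app2 (app2 (loopZ 5 pieceA) fun _ => L4 0) (app2 (loopZ 300 pieceV) fun _ => L4 1)
/-- On `y`: the code of `w = (a c^B d⁴)^n a b^{4n+1}`. [cite: Heuer2020, §4.1] -/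
def wCodeF : List Bool → List Bool := app2 (app2 (loopZ 300 pieceG) fun _ => L4 0) (app2 (loopZ 20 pieceB) fun _ => L4 1)
/-- On `y`: the CBI-`F₄` instance code `⟨⟨code v, code w⟩, 1^{4n}⟩`. [cite: Heuer2020, §4.1] -/
def coreF : List Bool → List Bool := fanoutFn (fanoutFn vCodeF wCodeF) (loopZ 4 pieceK)

/-- On `x`: the instance test of `ThreeDMVerifier` (`x = ⟨bin q, v⟩` canonical, `|v| = q³`). [folklore] -/
def T1x : List Bool → List Bool := ThreeDMNP.T1 ∘ fanoutFn id fun _ => []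
/-- On `x`: well formed and covered. [folklore] -/
def okT : List Bool → List Bool := andFn T1x (covT ∘ ctxF)
/-- A fixed no-instance of CBI-`F₄` (unrelated words). [folklore] -/
def noCode4 : List Bool := cbiInstanceCode 4 (([0], []), 0)
/-- **The reduction function** `THREEDM → CBI-F₄`. [cite: GareyJohnson1979, Thm. 4.3] [cite: Heuer2020, Thm. 3] -/
def redFn : List Bool → List Bool := iteFn okT (coreF ∘ ctxF) fun _ => noCode4

/-! #### Polynomial time -/

/-- `itemOf ∈ FP`. [folklore] -/
theorem itemOf_mem_FP {g : List Bool → List Bool} (hg : g ∈ FP) : itemOf g ∈ FP :=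
  app2_mem_FP (const_mem_FP _) (app2_mem_FP (comp_mem_FP (powB_mem_FP _) hg) (const_mem_FP _))
/-- `itemsZ ∈ FP`. [folklore] -/
theorem itemsZ_mem_FP : itemsZ ∈ FP :=
  app2_mem_FP (itemOf_mem_FP sizeU_mem_FP) (app2_mem_FP (itemOf_mem_FP (sizeO_mem_FP 0)) (app2_mem_FP (itemOf_mem_FP (sizeO_mem_FP 1))
    (itemOf_mem_FP (sizeO_mem_FP 2))))
/-- The bit test on `⟨y, 1^p⟩` is in `FP`. [folklore] -/
theorem bitTz_mem_FP : bitT fstF sndF ∈ FP := bitT_mem_FP fstF_mem_FP sndF_mem_FP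
/-- `pieceV ∈ FP`. [folklore] -/
theorem pieceV_mem_FP : pieceV ∈ FP := iteFn_mem_FP bitTz_mem_FP itemsZ_mem_FP (const_mem_FP _)
/-- `pieceA ∈ FP`. [folklore] -/
theorem pieceA_mem_FP : pieceA ∈ FP := iteFn_mem_FP bitTz_mem_FP (const_mem_FP _) (const_mem_FP _)
/-- `bY ∈ FP`. [folklore] -/
theorem bY_mem_FP : bY ∈ FP := app2_mem_FP (umul2_mem_FP (const_mem_FP _) (rPowY_mem_FP 3)) (const_mem_FP _)
/-- `groupCode ∈ FP`. [folklore] -/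
theorem groupCode_mem_FP : groupCode ∈ FP :=
  app2_mem_FP (const_mem_FP _) (app2_mem_FP (comp_mem_FP (powB_mem_FP _) bY_mem_FP) (const_mem_FP _))
/-- `pieceG ∈ FP`. [folklore] -/
theorem pieceG_mem_FP : pieceG ∈ FP := iteFn_mem_FP bitTz_mem_FP (comp_mem_FP groupCode_mem_FP fstF_mem_FP) (const_mem_FP _)
/-- `pieceB ∈ FP`. [folklore] -/
theorem pieceB_mem_FP : pieceB ∈ FP := iteFn_mem_FP bitTz_mem_FP (const_mem_FP _) (const_mem_FP _)
/-- `pieceK ∈ FP`. [folklore] -/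
theorem pieceK_mem_FP : pieceK ∈ FP := iteFn_mem_FP bitTz_mem_FP (const_mem_FP _) (const_mem_FP _)
/-- `loopZ C f ∈ FP` for `f ∈ FP` (clipped pieces). [cite: AroraBarakCC2009, §1.3 (bounded loops)] -/
theorem loopZ_mem_FP (C : ℕ) {f : List Bool → List Bool} (hf : f ∈ FP) : loopZ C f ∈ FP :=
  comp_mem_FP (sndPow_mem_FP 2) (comp_mem_FP (foldLoop_clipF_mem_FP C appF_mem_FP length_appF_le hf X)
    (fanoutFn_mem_FP id_mem_FP (fanoutFn_mem_FP (comp_mem_FP lenBinF_mem_FP q3Y_mem_FP) (const_mem_FP _))))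
/-- `vCodeF ∈ FP`. [folklore] -/
theorem vCodeF_mem_FP : vCodeF ∈ FP :=
  app2_mem_FP (app2_mem_FP (loopZ_mem_FP 5 pieceA_mem_FP) (const_mem_FP _)) (app2_mem_FP (loopZ_mem_FP 300 pieceV_mem_FP) (const_mem_FP _))
/-- `wCodeF ∈ FP`. [folklore] -/
theorem wCodeF_mem_FP : wCodeF ∈ FP :=
  app2_mem_FP (app2_mem_FP (loopZ_mem_FP 300 pieceG_mem_FP) (const_mem_FP _)) (app2_mem_FP (loopZ_mem_FP 20 pieceB_mem_FP) (const_mem_FP _))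
/-- `coreF ∈ FP`. [folklore] -/
theorem coreF_mem_FP : coreF ∈ FP := fanoutFn_mem_FP (fanoutFn_mem_FP vCodeF_mem_FP wCodeF_mem_FP) (loopZ_mem_FP 4 pieceK_mem_FP)
/-- `T1x ∈ FP`. [folklore] -/
theorem T1x_mem_FP : T1x ∈ FP := comp_mem_FP ThreeDMNP.T1_mem_FP (fanoutFn_mem_FP id_mem_FP (const_mem_FP _))
/-- `okT ∈ FP`. [folklore] -/
theorem okT_mem_FP : okT ∈ FP := andFn_mem_FP T1x_mem_FP (comp_mem_FP covT_mem_FP ctxF_mem_FP)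
/-- **`redFn ∈ FP`.** [cite: AroraBarakCC2009, §1.3] -/
theorem redFn_mem_FP : redFn ∈ FP := iteFn_mem_FP okT_mem_FP (comp_mem_FP coreF_mem_FP ctxF_mem_FP) (const_mem_FP _)

/-- `T1x` is one-bit. [folklore] -/
theorem oneBit_T1x : OneBit T1x := ThreeDMNP.oneBit_T1.comp _
/-- `covT` is one-bit (its yardstick always fits). [folklore] -/
theorem oneBit_covT : OneBit covT :=
  oneBit_allIdxFn (oneBit_anyIdx oneBit_bitT fun u => by
    simp only [q2Y, Function.comp_apply]
    exact (length_fstF_le' _).trans ((length_sndF_le' _).trans ((length_sndF_le' _).trans (length_fstF_le' _))))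
    fun u => (length_fstF_le' _).trans (length_sndF_le' _)
/-- `okT` is one-bit. [folklore] -/
theorem oneBit_okT : OneBit okT := oneBit_andFn oneBit_T1x (oneBit_covT.comp _)

end Pieces

/-! ### Values of the sizes and items at a position -/

section PieceValues

variable (q : ℕ) (v : List Bool) (p : ℕ)

/-- The record of position `p`. [folklore] -/
def zz : List Bool := boolPair (yCtx q v) (ones p)

/-- Value of `lowT`. [folklore] -/
theorem lowT_zz (c : ℕ) (hc : c < 3) : lowT c (zz q v p) = ones (coordN q c p * GJ4P.rr q ^ (c + 1)) := by
  rw [lowT, umul2_apply, coordF_apply (q := q) (v := v) (p := p) (by simp [zz]) (by simp [zz]), Function.comp_apply,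
    show fstF (zz q v p) = yCtx q v by simp [zz], rPowY_yCtx q v c (by omega), length_ones, length_ones]

/-- The sum of the low parts at position `p`. [folklore] -/
def lowN : ℕ := coordN q 0 p * GJ4P.rr q ^ 1 + coordN q 1 p * GJ4P.rr q ^ 2 + coordN q 2 p * GJ4P.rr q ^ 3

/-- Value of `lowSum`. [folklore] -/
theorem lowSum_zz : lowSum (zz q v p) = ones (lowN q p) := by
  rw [lowSum, app2_apply, app2_apply, lowT_zz q v p 0 (by norm_num), lowT_zz q v p 1 (by norm_num), lowT_zz q v p 2 (by norm_num),
    ones_append, ones_append, lowN, add_assoc]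

/-- Value of `cR4`. [folklore] -/
theorem cR4_zz (m : ℕ) : cR4 m (zz q v p) = ones (m * GJ4P.rr q ^ 4) := by
  rw [cR4, umul2_apply, Function.comp_apply, show fstF (zz q v p) = yCtx q v by simp [zz], rPowY_yCtx q v 3 (by norm_num),
    length_ones, length_ones]

/-- The `r⁴`-coefficient at position `p`, kind `c`. [folklore] -/
def coefN (c : ℕ) : ℕ := if FirstN q v c p then 10 else if c = 2 then 8 else 11

/-- Value of `coefT`. [folklore] -/
theorem coefT_zz (c : ℕ) : coefT c (zz q v p) = ones (coefN q v p c * GJ4P.rr q ^ 4) := by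
  rw [coefT, zz, iteFn_of_oneBit (oneBit_firstT c), firstT_apply, ← zz, cR4_zz, cR4_zz, coefN]
  by_cases h : FirstN q v c p <;> simp [h]

/-- The size of `u` at position `p`. [folklore] -/
def sizeUN : ℕ := 10 * GJ4P.rr q ^ 4 - lowN q p + 8

/-- Value of `sizeU`. [folklore] -/
theorem sizeU_zz : sizeU (zz q v p) = ones (sizeUN q p) := by
  rw [sizeU, app2_apply, usub_apply, cR4_zz, lowSum_zz, length_ones, drop_ones', ones_append, sizeUN]

/-- The size of the occurrence element of kind `c` at position `p`. [folklore] -/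
def sizeON (c : ℕ) : ℕ := coefN q v p c * GJ4P.rr q ^ 4 + coordN q c p * GJ4P.rr q ^ (c + 1) + residN c

/-- Value of `sizeO`. [folklore] -/
theorem sizeO_zz (c : ℕ) (hc : c < 3) : sizeO c (zz q v p) = ones (sizeON q v p c) := by
  rw [sizeO, app2_apply, app2_apply, coefT_zz, lowT_zz q v p c hc, ones_append, ones_append, sizeON, add_assoc]

/-- The code of a positive word of a cons. [folklore] -/
theorem code_cons (b : Fin 4) (u : List (Fin 4)) : clWordCode 4 (CBI.pos (b :: u)) = L4 b ++ clWordCode 4 (CBI.pos u) := by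
  simp [CBI.pos, clWordCode, L4]

/-- The code of a concatenation of positive words. [folklore] -/
theorem code_append (u u' : List (Fin 4)) : clWordCode 4 (CBI.pos (u ++ u')) = clWordCode 4 (CBI.pos u) ++ clWordCode 4 (CBI.pos u') := by
  simp [CBI.pos, clWordCode]

/-- The code of the empty word. [folklore] -/
@[simp] theorem code_nil : clWordCode 4 (CBI.pos ([] : List (Fin 4))) = [] := by simp [CBI.pos, clWordCode]

/-- The code of a constant word. [folklore] -/
theorem code_replicate (n : ℕ) (b : Fin 4) : clWordCode 4 (CBI.pos (List.replicate n b)) = (List.replicate n (L4 b)).flatten := by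
  induction n with
  | zero => simp
  | succ n ih => rw [List.replicate_succ, code_cons, ih, List.replicate_succ, List.flatten_cons]

/-- **The code of an item word** `b c^x d`. [cite: Heuer2020, §4.1] -/
theorem code_itemW (x : ℕ) : clWordCode 4 (CBI.pos (FPG.itemW x)) = L4 1 ++ (List.replicate x (L4 2)).flatten ++ L4 3 := by
  rw [FPG.itemW, code_cons, code_append, code_replicate, List.append_assoc]
  simp [CBI.pos, clWordCode, L4]

/-- **Value of `itemOf`**: the code of `b c^{|g|} d`. [folklore] -/
theorem itemOf_apply (g : List Bool → List Bool) (z : List Bool) : itemOf g z = clWordCode 4 (CBI.pos (FPG.itemW (g z).length)) := by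
  rw [itemOf, app2_apply, app2_apply, Function.comp_apply, powB_apply, code_itemW, List.append_assoc]

/-- The four items at position `p`. [folklore] -/
def itemsW : List (Fin 4) := FPG.itemW (sizeUN q p) ++ (FPG.itemW (sizeON q v p 0) ++ (FPG.itemW (sizeON q v p 1) ++ FPG.itemW (sizeON q v p 2)))

/-- **Value of `itemsZ`.** [folklore] -/
theorem itemsZ_zz : itemsZ (zz q v p) = clWordCode 4 (CBI.pos (itemsW q v p)) := by
  rw [itemsZ, app2_apply, app2_apply, app2_apply, itemOf_apply, itemOf_apply, itemOf_apply, itemOf_apply, sizeU_zz,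
    sizeO_zz q v p 0 (by norm_num), sizeO_zz q v p 1 (by norm_num), sizeO_zz q v p 2 (by norm_num), length_ones, length_ones,
    length_ones, length_ones, itemsW, code_append, code_append, code_append]

/-- Value of the bit test at position `p`. [folklore] -/
theorem bitT_zz : bitT fstF sndF (zz q v p) = [v.getD p false] := bitT_apply (q := q) (v := v) (p := p) (by simp [zz]) (by simp [zz])

/-- Value of `pieceV`. [folklore] -/
theorem pieceV_zz : pieceV (zz q v p) = if v.getD p false then clWordCode 4 (CBI.pos (itemsW q v p)) else [] := by
  rw [pieceV, iteFn_of_oneBit oneBit_bitT, bitT_zz, itemsZ_zz]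
  cases v.getD p false <;> simp

/-- Value of `pieceA`. [folklore] -/
theorem pieceA_zz : pieceA (zz q v p) = if v.getD p false then L4 0 else [] := by
  rw [pieceA, iteFn_of_oneBit oneBit_bitT, bitT_zz]
  cases v.getD p false <;> simp

/-- Value of `bY`. [folklore] -/
theorem bY_yCtx : bY (yCtx q v) = ones (GJ4P.bigB q) := by
  rw [bY, app2_apply, umul2_apply, rPowY_yCtx q v 3 (by norm_num), length_ones, length_ones, ones_append, GJ4P.bigB]

/-- **Value of `groupCode`**: the code of `a c^B d⁴`. [cite: Heuer2020, §4.1] -/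
theorem groupCode_yCtx : groupCode (yCtx q v) = clWordCode 4 (CBI.pos (FPG.groupW (GJ4P.bigB q))) := by
  rw [groupCode, app2_apply, app2_apply, Function.comp_apply, bY_yCtx, powB_apply, length_ones, FPG.groupW, code_cons, code_append,
    code_replicate, code_replicate]
  simp [L4, List.replicate_succ]

/-- Value of `pieceG`. [folklore] -/
theorem pieceG_zz : pieceG (zz q v p) = if v.getD p false then clWordCode 4 (CBI.pos (FPG.groupW (GJ4P.bigB q))) else [] := by
  rw [pieceG, iteFn_of_oneBit oneBit_bitT, bitT_zz, Function.comp_apply, show fstF (zz q v p) = yCtx q v by simp [zz],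
    groupCode_yCtx]
  cases v.getD p false <;> simp

/-- Value of `pieceB`. [folklore] -/
theorem pieceB_zz : pieceB (zz q v p) = if v.getD p false then clWordCode 4 (CBI.pos (List.replicate 4 1)) else [] := by
  rw [pieceB, iteFn_of_oneBit oneBit_bitT, bitT_zz, code_replicate]
  cases v.getD p false <;> simp [List.replicate_succ]

/-- Value of `pieceK`. [folklore] -/
theorem pieceK_zz : pieceK (zz q v p) = if v.getD p false then ones 4 else [] := by
  rw [pieceK, iteFn_of_oneBit oneBit_bitT, bitT_zz]
  cases v.getD p false <;> simp

end PieceValues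

/-! ### Set positions and the list of triples -/

section Triples

variable (q : ℕ) (v : List Bool)

/-- **The set positions below `N`, increasing.** [folklore] -/
def setPos (N : ℕ) : List ℕ := (List.range N).filter fun p => v.getD p false

/-- **The triples of the instance, in the order of their bits.** [cite: Karp1972, §3 problem 17] -/
def tl : List (Fin q × Fin q × Fin q) :=
  ((List.finRange (q * (q * q))).filter fun a => v.getD a.val false).map (finTripleEquiv q).symm

/-- The number of triples. [folklore] -/
def nSet : ℕ := (tl q v).length

/-- The positions of the listed triples are the set positions. [folklore] -/
theorem map_pos_tl : (tl q v).map (fun t => (finTripleEquiv q t).val) = setPos v (q * (q * q)) := by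
  rw [tl, List.map_map, setPos, ← List.map_coe_finRange_eq_range, List.filter_map]
  simp only [Function.comp_def, Equiv.apply_symm_apply]

/-- The number of set positions is the number of triples. [folklore] -/
theorem length_setPos : (setPos v (q * (q * q))).length = nSet q v := by
  rw [← map_pos_tl, List.length_map, nSet]

/-- The list of triples has no duplicates. [folklore] -/
theorem tl_nodup : (tl q v).Nodup :=
  (List.Nodup.filter _ (List.nodup_finRange _)).map (finTripleEquiv q).symm.injective

/-- Membership in the list of triples. [folklore] -/
theorem mem_tl_iff (t : Fin q × Fin q × Fin q) : t ∈ tl q v ↔ v.getD (finTripleEquiv q t).val false = true := by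
  rw [tl, List.mem_map]
  constructor
  · rintro ⟨a, ha, rfl⟩
    rw [List.mem_filter] at ha
    simpa using ha.2
  · intro h
    exact ⟨finTripleEquiv q t, List.mem_filter.2 ⟨List.mem_finRange _, h⟩, Equiv.symm_apply_apply _ _⟩

/-- The listed triples are those of `ThreeDMVerifier`'s `trip`. [folklore] -/
theorem toFinset_tl : (tl q v).toFinset = ThreeDMNP.trip q v := by
  ext t
  rw [List.mem_toFinset, mem_tl_iff, ThreeDMNP.trip, Finset.mem_filter]
  simp

/-- The position of the `l`-th triple. [folklore] -/
theorem getElem_setPos (l : ℕ) (hl : l < (tl q v).length) :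
    (setPos v (q * (q * q)))[l]'(by rw [length_setPos, nSet]; exact hl) = (finTripleEquiv q (tl q v)[l]).val := by
  simp only [← map_pos_tl, List.getElem_map]

/-- Set positions are set and in range. [folklore] -/
theorem mem_setPos_iff {N p : ℕ} : p ∈ setPos v N ↔ p < N ∧ v.getD p false = true := by
  simp [setPos, List.mem_filter, List.mem_range]

/-- Set positions increase. [folklore] -/
theorem setPos_lt_of_lt {N l l' : ℕ} (hl' : l' < (setPos v N).length) (h : l < l') :
    (setPos v N)[l]'(h.trans hl') < (setPos v N)[l'] := by
  have hp : (setPos v N).Pairwise (· < ·) := List.pairwise_lt_range.filter _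
  exact (List.pairwise_iff_getElem.1 hp) l l' _ _ h

end Triples

/-! ### The loops: set positions in increasing order -/

section LoopValues

variable (q : ℕ) (v : List Bool)

/-- **Value of a loop over the positions** (pieces short enough not to be clipped). [cite: AroraBarakCC2009, §1.3] -/
theorem loopZ_yCtx (hv : v.length = q * (q * q)) (C : ℕ) (f : List Bool → List Bool)
    (hC : ∀ p, p < q * (q * q) → (f (zz q v p)).length ≤ C * ((yCtx q v).length + 1)) :
    loopZ C f (yCtx q v) = ccat (fun p => f (zz q v p)) (q * (q * q)) := by
  have hinit : fanoutFn id (fanoutFn (lenBinF ∘ q3Y) fun _ => boolPair [] []) (yCtx q v) =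
      boolPair (yCtx q v) (boolPair (encodeNat (q * (q * q))) (boolPair (ones 0) [])) := by
    simp [ones]
  have hlen : q * (q * q) ≤ (X : Polynomial ℕ).eval (yCtx q v).length := by
    rw [eval_X, ← hv]; exact length_v_le_yCtx q v
  rw [loopZ, Function.comp_apply, Function.comp_apply, hinit, foldLoop_apply appF _ hlen 0 [], sndPow_succ_boolPair,
    sndPow_succ_boolPair, sndPow_zero_boolPair, foldAcc_clipF (fun j _ hj => by rw [Nat.zero_add] at hj; exact hC j hj),
    foldAcc_appF, List.nil_append]
  exact ccat_congr fun j _ => by rw [Nat.zero_add]; rfl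

/-- A concatenation of pieces present exactly at the set positions. [folklore] -/
theorem ccat_ite (F : ℕ → List Bool) : ∀ N, ccat (fun p => if v.getD p false then F p else []) N = (setPos v N).flatMap F
  | 0 => by simp [setPos]
  | N + 1 => by
    rw [ccat_succ, ccat_ite F N, setPos, setPos, List.range_succ, List.filter_append, List.flatMap_append]
    congr 1
    cases hb : v.getD N false <;> simp only [hb, List.filter_singleton] <;> simp

/-- A constant `flatMap` is a flattened replicate. [folklore] -/
theorem flatMap_const {α β : Type*} (l : List α) (c : List β) : l.flatMap (fun _ => c) = (List.replicate l.length c).flatten := by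
  induction l with
  | nil => rfl
  | cons a l ih => rw [List.flatMap_cons, ih, List.length_cons, List.replicate_succ, List.flatten_cons]

/-- The code of a flattening. [folklore] -/
theorem code_flatten (L : List (List (Fin 4))) : clWordCode 4 (CBI.pos L.flatten) = (L.map fun u => clWordCode 4 (CBI.pos u)).flatten := by
  induction L with
  | nil => simp
  | cons u L ih => rw [List.flatten_cons, code_append, ih, List.map_cons, List.flatten_cons]

/-- The code of a `flatMap`. [folklore] -/
theorem code_flatMap {α : Type*} (l : List α) (g : α → List (Fin 4)) :
    clWordCode 4 (CBI.pos (l.flatMap g)) = l.flatMap fun a => clWordCode 4 (CBI.pos (g a)) := by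
  induction l with
  | nil => simp
  | cons a l ih => rw [List.flatMap_cons, code_append, ih, List.flatMap_cons]

/-- **The word `v` produced by the machine** (before identification with `FPG.vWord`). [folklore] -/
def vM : List (Fin 4) := List.replicate (nSet q v + 1) 0 ++ (setPos v (q * (q * q))).flatMap (itemsW q v) ++ [1]

variable (hv : v.length = q * (q * q))
include hv

omit hv in
/-- Coordinates of positions are `< q`. [folklore] -/
theorem coordN_lt {p : ℕ} (hp : p < q * (q * q)) (c : ℕ) : coordN q c p < q := by
  have hq : 0 < q := Nat.pos_of_ne_zero fun h => by subst h; simp at hp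
  unfold coordN
  split_ifs
  · exact (Nat.div_lt_iff_lt_mul (Nat.mul_pos hq hq)).2 (by simpa [Nat.mul_comm, Nat.mul_assoc] using hp)
  · exact (Nat.div_lt_iff_lt_mul hq).2 (Nat.mod_lt _ (Nat.mul_pos hq hq))
  · exact Nat.mod_lt _ hq

omit hv in
/-- The pieces of the item loop are short. [folklore] -/
theorem length_itemsW_le {p : ℕ} (hp : p < q * (q * q)) : (clWordCode 4 (CBI.pos (itemsW q v p))).length ≤ 300 * ((yCtx q v).length + 1) := by
  have hy := r4_le_yCtx q v
  have hq : 0 < q := Nat.pos_of_ne_zero fun h => by subst h; simp at hp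
  have hr : q ≤ GJ4P.rr q := by unfold GJ4P.rr; omega
  have hr1 : 1 ≤ GJ4P.rr q := by omega
  -- each low part is at most `r⁴`
  have hlow : ∀ c, c < 3 → coordN q c p * GJ4P.rr q ^ (c + 1) ≤ GJ4P.rr q ^ 4 := by
    intro c hc
    have h1 : coordN q c p ≤ GJ4P.rr q := (coordN_lt q hp c).le.trans hr
    have h2 : GJ4P.rr q ^ (c + 1) ≤ GJ4P.rr q ^ 3 := Nat.pow_le_pow_right hr1 (by omega)
    calc coordN q c p * GJ4P.rr q ^ (c + 1) ≤ GJ4P.rr q * GJ4P.rr q ^ 3 := Nat.mul_le_mul h1 h2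
      _ = GJ4P.rr q ^ 4 := by ring
  have hcoef : ∀ c, coefN q v p c ≤ 11 := fun c => by unfold coefN; split_ifs <;> omega
  have hres : ∀ c, residN c ≤ 4 := fun c => by unfold residN; split_ifs <;> omega
  have hU : sizeUN q p ≤ 10 * GJ4P.rr q ^ 4 + 8 := by unfold sizeUN; omega
  have hO : ∀ c, c < 3 → sizeON q v p c ≤ 12 * GJ4P.rr q ^ 4 + 4 := by
    intro c hc
    unfold sizeON
    have := hlow c hc
    have := Nat.mul_le_mul_right (GJ4P.rr q ^ 4) (hcoef c)
    have := hres c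
    omega
  rw [CBIRed.length_clWordCode_pos]
  simp only [itemsW, List.length_append, FPG.length_itemW]
  have h0 := hO 0 (by norm_num)
  have h1 := hO 1 (by norm_num)
  have h2 := hO 2 (by norm_num)
  omega

omit hv in
/-- The pieces of the group loop are short. [folklore] -/
theorem length_groupCode_le : (clWordCode 4 (CBI.pos (FPG.groupW (GJ4P.bigB q)))).length ≤ 300 * ((yCtx q v).length + 1) := by
  have hy := r4_le_yCtx q v
  rw [CBIRed.length_clWordCode_pos, FPG.length_groupW, GJ4P.bigB]
  omega

/-- **Value of the four loops.** [folklore] -/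
theorem loops_yCtx :
    loopZ 5 pieceA (yCtx q v) = (List.replicate (nSet q v) (L4 0)).flatten ∧
    loopZ 300 pieceV (yCtx q v) = clWordCode 4 (CBI.pos ((setPos v (q * (q * q))).flatMap (itemsW q v))) ∧
    loopZ 300 pieceG (yCtx q v) = clWordCode 4 (CBI.pos (List.replicate (nSet q v) (FPG.groupW (GJ4P.bigB q))).flatten) ∧
    loopZ 20 pieceB (yCtx q v) = (List.replicate (nSet q v) (clWordCode 4 (CBI.pos (List.replicate 4 1)))).flatten ∧
    loopZ 4 pieceK (yCtx q v) = (List.replicate (nSet q v) (ones 4)).flatten := by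
  refine ⟨?_, ?_, ?_, ?_, ?_⟩
  · rw [loopZ_yCtx q v hv 5 pieceA (fun p _ => by rw [pieceA_zz]; split_ifs <;> simp [L4, clLetterCode] )]
    simp only [pieceA_zz]
    rw [ccat_ite, flatMap_const, length_setPos]
  · rw [loopZ_yCtx q v hv 300 pieceV (fun p hp => by
      rw [pieceV_zz]; split_ifs
      · exact length_itemsW_le q v hp
      · simp)]
    simp only [pieceV_zz]
    rw [ccat_ite, code_flatMap]
  · rw [loopZ_yCtx q v hv 300 pieceG (fun p _ => by
      rw [pieceG_zz]; split_ifs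
      · exact length_groupCode_le q v
      · simp)]
    simp only [pieceG_zz]
    rw [ccat_ite, flatMap_const, code_flatten, List.map_replicate, length_setPos]
  · rw [loopZ_yCtx q v hv 20 pieceB (fun p _ => by
      rw [pieceB_zz]; split_ifs
      · rw [CBIRed.length_clWordCode_pos]; simp
      · simp)]
    simp only [pieceB_zz]
    rw [ccat_ite, flatMap_const, length_setPos]
  · rw [loopZ_yCtx q v hv 4 pieceK (fun p _ => by rw [pieceK_zz]; split_ifs <;> simp)]
    simp only [pieceK_zz]
    rw [ccat_ite, flatMap_const, length_setPos]

omit hv in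
/-- Blocks of blocks. [folklore] -/
theorem flatten_replicate_flatten {α : Type*} (n m : ℕ) (c : List α) :
    (List.replicate n (List.replicate m c).flatten).flatten = (List.replicate (m * n) c).flatten := by
  induction n with
  | zero => simp
  | succ n ih => rw [List.replicate_succ, List.flatten_cons, ih, Nat.mul_succ, Nat.add_comm, List.replicate_add, List.flatten_append]

/-- **Value of the core map on the context record**: the CBI-`F₄` instance code of
`(v_M, w, 4n)`. [cite: Heuer2020, §4.1] -/
theorem coreF_yCtx : coreF (yCtx q v) = cbiInstanceCode 4 ((vM q v, FPG.wWord (nSet q v) (GJ4P.bigB q)), 4 * nSet q v) := by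
  obtain ⟨hA, hV, hG, hB, hK⟩ := loops_yCtx q v hv
  rw [coreF, fanoutFn_apply, fanoutFn_apply, vCodeF, wCodeF, app2_apply, app2_apply, app2_apply, app2_apply, app2_apply,
    app2_apply, hA, hV, hG, hB, hK, cbiInstanceCode]
  simp only []
  congr 2
  · rw [vM, code_append, code_append, List.replicate_succ', code_append, code_replicate]
    simp [L4, CBI.pos, clWordCode]
  · have e1 : clWordCode 4 (CBI.pos (List.replicate (4 * nSet q v + 1) (1 : Fin 4))) =
        (List.replicate (nSet q v) (clWordCode 4 (CBI.pos (List.replicate 4 (1 : Fin 4))))).flatten ++ L4 1 := by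
      rw [code_replicate, code_replicate, flatten_replicate_flatten, List.replicate_succ', List.flatten_append, List.flatten_singleton]
    rw [FPG.wWord, code_append, code_append, e1]
    simp [L4, CBI.pos, clWordCode]
  · rw [show ones 4 = List.replicate 4 true from rfl, List.flatten_replicate_replicate, OracleCompose.unaryEncodeNat_eq_replicate,
      Nat.mul_comm]

end LoopValues


/-! ### Identification with the 4-PARTITION instance of the triples -/

section Ident

variable (q : ℕ) (v : List Bool)

/-- Abbreviation: the position of the `l`-th triple. [folklore] -/
def posOf (l : Fin (tl q v).length) : ℕ := (finTripleEquiv q (tl q v)[l]).val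

/-- `posOf l` is the `l`-th set position. [folklore] -/
theorem setPos_getElem_eq_posOf (l : Fin (tl q v).length) :
    (setPos v (q * (q * q)))[l.val]'(by rw [length_setPos, nSet]; exact l.isLt) = posOf q v l :=
  getElem_setPos q v l.val l.isLt

/-- The bit of a listed triple is set. [folklore] -/
theorem getD_posOf (l : Fin (tl q v).length) : v.getD (posOf q v l) false = true :=
  (mem_tl_iff q v _).1 (List.getElem_mem _)

/-- Coordinates of the position of the `l`-th triple. [folklore] -/
theorem coordN_posOf (l : Fin (tl q v).length) (c : Fin 3) : coordN q c.val (posOf q v l) = GJ4P.coord (tl q v)[l] c :=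
  coordN_finTripleEquiv q _ c

/-- Positions of listed triples increase with the index. [folklore] -/
theorem posOf_lt_posOf {a b : Fin (tl q v).length} (h : a < b) : posOf q v a < posOf q v b := by
  rw [← setPos_getElem_eq_posOf, ← setPos_getElem_eq_posOf]
  exact setPos_lt_of_lt v (by rw [length_setPos, nSet]; exact b.isLt) h

/-- A set position below `q³` is the position of a listed triple. [folklore] -/
theorem exists_posOf_eq {p : ℕ} (hp : p < q * (q * q)) (hbit : v.getD p false = true) : ∃ l : Fin (tl q v).length, posOf q v l = p := by
  have hmem : p ∈ setPos v (q * (q * q)) := (mem_setPos_iff v).2 ⟨hp, hbit⟩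
  obtain ⟨n', hn', hpeq⟩ := List.mem_iff_getElem.1 hmem
  have hn'l : n' < (tl q v).length := by have := length_setPos q v; unfold nSet at this; omega
  refine ⟨⟨n', hn'l⟩, ?_⟩
  rw [← setPos_getElem_eq_posOf]
  exact hpeq

/-- **The machine's first-occurrence flag is `GJ4P.First`.** [cite: GareyJohnson1979, Thm. 4.3] -/
theorem firstN_iff (l : Fin (tl q v).length) (c : Fin 3) : FirstN q v c.val (posOf q v l) ↔ GJ4P.First (tl q v) l c := by
  constructor
  · intro hF l' hl'
    have := hF _ (posOf_lt_posOf q v hl')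
    rw [not_and, coordN_posOf, coordN_posOf] at this
    exact this (getD_posOf q v l')
  · rintro hF p' hp' ⟨hbit, hco⟩
    have hp'N : p' < q * (q * q) := lt_trans hp' (Fin.isLt _)
    obtain ⟨l', rfl⟩ := exists_posOf_eq q v hp'N hbit
    have hll : l' < l := by
      by_contra hge
      push Not at hge
      rcases hge.lt_or_eq with hgt | heq
      · exact absurd (posOf_lt_posOf q v hgt) (not_lt.2 hp'.le)
      · rw [heq] at hp'; exact lt_irrefl _ hp'
    apply hF l' hll
    rw [← coordN_posOf, ← coordN_posOf]
    exact hco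

/-- **The machine's sizes are `GJ4P.size`**, kind `u`. [cite: GareyJohnson1979, Thm. 4.3] -/
theorem size_zero_eq (l : Fin (tl q v).length) : GJ4P.size (tl q v) (l, 0) = sizeUN q (posOf q v l) := by
  have h0 := coordN_posOf q v l 0
  have h1 := coordN_posOf q v l 1
  have h2 := coordN_posOf q v l 2
  simp only [Fin.val_zero, Fin.val_one, Fin.val_two, Fin.getElem_fin] at h0 h1 h2
  simp only [GJ4P.size, sizeUN, lowN, GJ4P.low, if_true, Fin.val_zero, Fin.val_one, Fin.val_two, Fin.getElem_fin, h0, h1, h2]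

/-- **The machine's sizes are `GJ4P.size`**, occurrence kinds. [cite: GareyJohnson1979, Thm. 4.3] -/
theorem size_succ_eq (l : Fin (tl q v).length) (c : Fin 3) : GJ4P.size (tl q v) (l, c.succ) = sizeON q v (posOf q v l) c.val := by
  have hk : GJ4P.kind c.succ = c := by apply Fin.ext; simp [GJ4P.kind]
  have hne : c.succ ≠ 0 := Fin.succ_ne_zero c
  have hf := firstN_iff q v l c
  have hc := coordN_posOf q v l c
  simp only [Fin.getElem_fin] at hc
  rw [GJ4P.size, if_neg hne]
  simp only [hk, sizeON, coefN, GJ4P.coef, GJ4P.low, Fin.getElem_fin, hc, hf]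
  have hres : GJ4P.resid c.succ = residN c.val := by
    obtain rfl | rfl | rfl : c = 0 ∨ c = 1 ∨ c = 2 := by omega
    all_goals decide
  have hc2 : (c = 2) ↔ (c.val = 2) := by omega
  rw [hres]
  by_cases hF : GJ4P.First (tl q v) l c
  · simp [hF]
  · by_cases h2 : c = 2
    · simp [h2]
    · have h2' : c.val ≠ 2 := fun h => h2 (hc2.2 h)
      simp [hF, h2, h2']

/-- Blocks of equal length: indexing a flattening. [folklore] -/
theorem getElem_flatten_of_length {α : Type*} (m : ℕ) : ∀ (L : List (List α)) (hL : ∀ b ∈ L, b.length = m) (l κ : ℕ)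
    (hl : l < L.length) (hκ : κ < m) (h : m * l + κ < L.flatten.length), L.flatten[m * l + κ] = (L[l])[κ]'(by rw [hL _ (List.getElem_mem _)]; exact hκ)
  | [], _, l, κ, hl, _, _ => by simp at hl
  | b :: L, hL, 0, κ, hl, hκ, h => by
    have hb : b.length = m := hL b (by simp)
    simp only [List.flatten_cons, Nat.mul_zero, Nat.zero_add, List.getElem_cons_zero]
    exact List.getElem_append_left (by rw [hb]; exact hκ)
  | b :: L, hL, l + 1, κ, hl, hκ, h => by
    have hb : b.length = m := hL b (by simp)
    have e : m * (l + 1) + κ = b.length + (m * l + κ) := by rw [hb]; ring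
    simp only [List.flatten_cons, e, List.getElem_cons_succ]
    rw [List.getElem_append_right (by omega)]
    simp only [Nat.add_sub_cancel_left]
    exact getElem_flatten_of_length m L (fun b' hb' => hL b' (List.mem_cons_of_mem _ hb')) l κ (by simpa using hl) hκ _

/-- **`GJ4P.sizes` listed triple by triple.** [folklore] -/
theorem sizes_eq_flatMap {q : ℕ} (T : List (Fin q × Fin q × Fin q)) :
    GJ4P.sizes T = (List.finRange T.length).flatMap fun l =>
      [GJ4P.size T (l, 0), GJ4P.size T (l, 1), GJ4P.size T (l, 2), GJ4P.size T (l, 3)] := by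
  set L : List (List ℕ) := (List.finRange T.length).map fun l =>
    [GJ4P.size T (l, 0), GJ4P.size T (l, 1), GJ4P.size T (l, 2), GJ4P.size T (l, 3)] with hL
  have hLm : ∀ b ∈ L, b.length = 4 := by
    intro b hb; obtain ⟨l, -, rfl⟩ := List.mem_map.1 hb; rfl
  have hfl : ((List.finRange T.length).flatMap fun l =>
      [GJ4P.size T (l, 0), GJ4P.size T (l, 1), GJ4P.size T (l, 2), GJ4P.size T (l, 3)]) = L.flatten := by
    rw [hL, List.flatMap_def]
  have hlen : L.flatten.length = 4 * T.length := by
    rw [List.length_flatten, hL, List.map_map]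
    have : (List.map (List.length ∘ fun l => [GJ4P.size T (l, 0), GJ4P.size T (l, 1), GJ4P.size T (l, 2), GJ4P.size T (l, 3)])
        (List.finRange T.length)) = List.replicate T.length 4 := by
      rw [List.eq_replicate_iff]; exact ⟨by simp, fun b hb => by obtain ⟨l, -, rfl⟩ := List.mem_map.1 hb; rfl⟩
    rw [this, List.sum_replicate, smul_eq_mul, Nat.mul_comm]
  rw [hfl]
  apply List.ext_getElem (by rw [GJ4P.length_sizes, hlen])
  intro a h1 h2
  rw [hlen] at h2
  -- `a = 4 l + κ`
  obtain ⟨l, κ, hκ, rfl⟩ : ∃ l κ, κ < 4 ∧ a = 4 * l + κ := ⟨a / 4, a % 4, Nat.mod_lt _ (by norm_num), (Nat.div_add_mod a 4).symm⟩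
  have hl : l < T.length := by omega
  have hLl : L.length = T.length := by simp [hL]
  rw [getElem_flatten_of_length 4 L hLm l κ (by rw [hLl]; exact hl) hκ]
  have hslot : (GJ4P.slotEquiv T).symm ⟨4 * l + κ, h2⟩ = (⟨l, hl⟩, ⟨κ, hκ⟩) := by
    rw [Equiv.symm_apply_eq]; apply Fin.ext; rw [GJ4P.slotEquiv_val]
  have e1 : (GJ4P.sizes T)[4 * l + κ] = GJ4P.size T (⟨l, hl⟩, ⟨κ, hκ⟩) := by
    rw [← hslot]; exact GJ4P.sizes_getElem T ⟨4 * l + κ, h2⟩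
  rw [e1]
  have four : ∀ (f : Fin 4 → ℕ) (κ' : ℕ) (hκ' : κ' < 4) (h4 : κ' < [f 0, f 1, f 2, f 3].length),
      [f 0, f 1, f 2, f 3][κ'] = f ⟨κ', hκ'⟩ := by
    intro f κ' hκ' _
    interval_cases κ' <;> rfl
  simp only [hL, List.getElem_map, List.getElem_finRange]
  exact (four (fun κ' => GJ4P.size T (⟨l, hl⟩, κ')) κ hκ _).symm

end Ident


/-! ### The produced words are Heuer's gadget words of the Garey–Johnson instance -/

section Words

variable (q : ℕ) (v : List Bool)

/-- The set positions, triple by triple. [folklore] -/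
theorem setPos_eq_map_posOf : setPos v (q * (q * q)) = (List.finRange (tl q v).length).map (posOf q v) := by
  apply List.ext_getElem (by simp [length_setPos, nSet])
  intro l h1 h2
  rw [List.getElem_map, List.getElem_finRange]
  exact getElem_setPos q v l (by simpa using h2)

/-- The items at the position of the `l`-th triple are the item words of its four sizes. [folklore] -/
theorem itemsW_posOf (l : Fin (tl q v).length) :
    itemsW q v (posOf q v l) = [GJ4P.size (tl q v) (l, 0), GJ4P.size (tl q v) (l, 1), GJ4P.size (tl q v) (l, 2),
      GJ4P.size (tl q v) (l, 3)].flatMap FPG.itemW := by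
  rw [itemsW, size_zero_eq, show ((l, 1) : Fin (tl q v).length × Fin 4) = (l, (0 : Fin 3).succ) from rfl, size_succ_eq,
    show ((l, 2) : Fin (tl q v).length × Fin 4) = (l, (1 : Fin 3).succ) from rfl, size_succ_eq,
    show ((l, 3) : Fin (tl q v).length × Fin 4) = (l, (2 : Fin 3).succ) from rfl, size_succ_eq]
  simp

/-- **The items of the machine are those of the instance `sizes (tl q v)`.** [folklore] -/
theorem flatMap_itemsW : (setPos v (q * (q * q))).flatMap (itemsW q v) = (GJ4P.sizes (tl q v)).flatMap FPG.itemW := by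
  rw [setPos_eq_map_posOf, List.flatMap_map, sizes_eq_flatMap, List.flatMap_assoc]
  exact List.flatMap_congr fun l _ => itemsW_posOf q v l

/-- **The word produced by the machine is `v` of the gadget.** [cite: Heuer2020, §4.1] -/
theorem vM_eq : vM q v = FPG.vWord (GJ4P.sizes (tl q v)) (nSet q v) := by
  rw [vM, flatMap_itemsW, FPG.vWord]

end Words

/-! ### Coverage and membership -/

section Membership

variable (q : ℕ) (v : List Bool)

/-- **The coverage test is `W`-coverage of the listed triples.** [cite: GareyJohnson1979, Thm. 4.3] -/
theorem covered_iff : Covered q v ↔ ∀ z, z < q → ∃ l : Fin (tl q v).length, GJ4P.coord (tl q v)[l] 0 = z := by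
  constructor
  · intro h z hz
    obtain ⟨p, hp, hbit⟩ := h z hz
    have hq : 0 < q := by omega
    have hqq : 0 < q * q := Nat.mul_pos hq hq
    have hP : z * (q * q) + p < q * (q * q) := by nlinarith
    obtain ⟨l, hl⟩ := exists_posOf_eq q v hP hbit
    refine ⟨l, ?_⟩
    have := coordN_posOf q v l 0
    rw [hl] at this
    rw [← this]
    simp only [coordN, Fin.val_zero, if_true]
    rw [Nat.add_comm, Nat.add_mul_div_right _ _ hqq, Nat.div_eq_of_lt hp, Nat.zero_add]
  · intro h z hz
    obtain ⟨l, hl⟩ := h z hz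
    have hq : 0 < q := by omega
    have hqq : 0 < q * q := Nat.mul_pos hq hq
    have hc := coordN_posOf q v l 0
    rw [hl] at hc
    simp only [coordN, Fin.val_zero, if_true] at hc
    refine ⟨posOf q v l % (q * q), Nat.mod_lt _ hqq, ?_⟩
    have e : z * (q * q) + posOf q v l % (q * q) = posOf q v l := by
      rw [← hc]; exact Nat.div_add_mod' _ _
    rw [e]
    exact getD_posOf q v l

end Membership

/-! ### The reduction -/

section Reduction

/-- **Membership in `THREEDM` of a well-formed code** is membership of the coded instance. [cite: Karp1972, §3 problem 17] -/
theorem mem_THREEDM_iff_of_C1 {x : List Bool} (hC : ThreeDMNP.C1 x) :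
    x ∈ THREEDM ↔ (⟨bitsToNat (fstF x), ThreeDMNP.trip (bitsToNat (fstF x)) (sndF x)⟩ : Σ n, Finset (Fin n × Fin n × Fin n)) ∈ threeDMSet := by
  obtain ⟨hx, hlen⟩ := hC
  have henc : encodingTriples.encode ⟨bitsToNat (fstF x), ThreeDMNP.trip (bitsToNat (fstF x)) (sndF x)⟩ = x := by
    rw [ThreeDMNP.encode_trip hlen]; exact hx.symm
  conv_lhs => rw [← henc]
  rw [THREEDM, Encoding.mem_toLanguage_iff]

/-- Every code of an instance is well formed. [folklore] -/
theorem C1_encode (p : Σ n, Finset (Fin n × Fin n × Fin n)) : ThreeDMNP.C1 (encodingTriples.encode p) := by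
  refine ⟨?_, ?_⟩
  · rw [ThreeDMNP.fstF_encode, bitsToNat_encodeNat, encodingTriples_encode, sndF_boolPair]
  · rw [ThreeDMNP.length_sndF_encode, ThreeDMNP.fstF_encode, bitsToNat_encodeNat]

/-- Ill-formed strings are not in `THREEDM`. [folklore] -/
theorem not_mem_THREEDM_of_not_C1 {x : List Bool} (hC : ¬ThreeDMNP.C1 x) : x ∉ THREEDM := by
  rintro ⟨p, -, rfl⟩
  exact hC (C1_encode p)

/-- Truth of the instance test on `x` itself. [folklore] -/
theorem T1x_eq_true_iff (x : List Bool) : T1x x = [true] ↔ ThreeDMNP.C1 x := by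
  rw [T1x, Function.comp_apply, fanoutFn_apply, ThreeDMNP.T1_eq_true_iff, fstF_boolPair]
  rfl

/-- The no-instance is a no-instance. [folklore] -/
theorem noCode4_not_mem : noCode4 ∉ cbiLanguage 4 := by
  rw [noCode4, cbiInstanceCode_mem_cbiLanguage_iff]
  rintro ⟨hperm, -⟩
  simpa using hperm.length_eq

/-- A perfect matching among the listed triples covers every `w`-value. [folklore] -/
theorem covered_of_matching {q : ℕ} {v : List Bool} {W : Finset (Fin q × Fin q × Fin q)} (hW : W ⊆ (tl q v).toFinset)
    (hcard : W.card = q) (hm : IsThreeDMatching W) : Covered q v := by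
  rw [covered_iff]
  intro z hz
  obtain ⟨t, ht, htz⟩ := GJ4P.exists_coord_eq hcard hm 0 hz
  obtain ⟨n, hn, rfl⟩ := List.mem_iff_getElem.1 (List.mem_toFinset.1 (hW ht))
  exact ⟨⟨n, hn⟩, htz⟩

/-- **The reduction is correct.** [cite: GareyJohnson1979, Thm. 4.3] [cite: Heuer2020, Thm. 4.1] -/
theorem redFn_spec (x : List Bool) : x ∈ THREEDM ↔ redFn x ∈ cbiLanguage 4 := by
  by_cases hok : okT x = [true]
  · -- well formed and covered
    have hT1 : T1x x = [true] := by
      obtain ⟨b, hb⟩ := oneBit_T1x x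
      obtain ⟨b', hb'⟩ := (oneBit_covT.comp ctxF) x
      rw [okT, andFn_apply hb hb'] at hok
      cases b <;> simp_all
    have hcov' : (covT ∘ ctxF) x = [true] := by
      obtain ⟨b, hb⟩ := oneBit_T1x x
      obtain ⟨b', hb'⟩ := (oneBit_covT.comp ctxF) x
      rw [okT, andFn_apply hb hb'] at hok
      rw [hb']
      cases b <;> cases b' <;> simp_all
    have hC : ThreeDMNP.C1 x := (T1x_eq_true_iff x).1 hT1
    set q := bitsToNat (fstF x) with hq
    set v := sndF x with hvdef
    have hxv : x = boolPair (encodeNat q) v := hC.1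
    have hlen : v.length = q * (q * q) := hC.2
    have hctx : ctxF x = yCtx q v := by rw [hxv]; exact ctxF_code q v hlen
    have hcov : Covered q v := by
      rw [Function.comp_apply, hctx, covT_apply] at hcov'
      simpa using hcov'
    rw [redFn, iteFn_apply_true hok, Function.comp_apply, hctx, coreF_yCtx q v hlen, vM_eq, cbiInstanceCode_mem_cbiLanguage_iff,
      mem_THREEDM_iff_of_C1 hC]
    change (⟨q, ThreeDMNP.trip q v⟩ : Σ n, Finset (Fin n × Fin n × Fin n)) ∈ threeDMSet ↔
      (List.Perm (FPG.vWord (GJ4P.sizes (tl q v)) (tl q v).length) (FPG.wWord (tl q v).length (GJ4P.bigB q)) ∧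
        CBI.dcbi (FPG.vWord (GJ4P.sizes (tl q v)) (tl q v).length) (FPG.wWord (tl q v).length (GJ4P.bigB q)) ≤ 4 * (tl q v).length)
    have hcovT : ∀ z, z < q → ∃ l : Fin (tl q v).length, GJ4P.coord (tl q v)[l] 0 = z := (covered_iff q v).1 hcov
    rw [← FPG.solvable_iff (GJ4P.sizes (tl q v)) (tl q v).length (GJ4P.bigB q) (GJ4P.length_sizes _)
      (fun a ha => (GJ4P.bounds_sizes _ a ha).1) (fun a ha => (GJ4P.bounds_sizes _ a ha).2),
      ← GJ4P.matching_iff (tl q v) (tl_nodup q v) hcovT, toFinset_tl]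
    rfl
  · -- ill formed or uncovered: a no-instance on both sides
    have hok' : okT x = [false] := by
      obtain ⟨b, hb⟩ := oneBit_okT x
      cases b
      · exact hb
      · exact absurd hb hok
    rw [redFn, iteFn_apply_false hok']
    simp only [noCode4_not_mem, iff_false]
    intro hx
    apply hok
    -- `x ∈ THREEDM` forces well-formedness and coverage
    have hC : ThreeDMNP.C1 x := by
      by_contra h; exact not_mem_THREEDM_of_not_C1 h hx
    have hT1 : T1x x = [true] := (T1x_eq_true_iff x).2 hC
    set q := bitsToNat (fstF x) with hq
    set v := sndF x with hvdef
    have hxv : x = boolPair (encodeNat q) v := hC.1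
    have hlen : v.length = q * (q * q) := hC.2
    have hctx : ctxF x = yCtx q v := by rw [hxv]; exact ctxF_code q v hlen
    obtain ⟨W, hW, hcard, hm⟩ := (mem_THREEDM_iff_of_C1 hC).1 hx
    have hcov : Covered q v := covered_of_matching (by rw [toFinset_tl]; exact hW) hcard hm
    have hcov' : (covT ∘ ctxF) x = [true] := by
      rw [Function.comp_apply, hctx, covT_apply]; simpa using hcov
    rw [okT, andFn_apply hT1 hcov']
    rfl

/-- **`THREEDM ≤ₚ` CBI-`F₄`** (Garey–Johnson's 4-PARTITION instance fed into Heuer's gadget).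
[cite: GareyJohnson1979, Thm. 4.3] [cite: Heuer2020, Thm. 3 and Thm. 4.1] -/
theorem THREEDM_karpReducible_cbiLanguage_four : THREEDM ≤ₚ cbiLanguage 4 :=
  polyTimeKarpReducible_iff.2 ⟨redFn, redFn_mem_FP, redFn_spec⟩

/-- **CBI over four letters is NP-hard** (from the tree's NP-hardness of `THREEDM`).
[cite: Heuer2020, Thm. 3] -/
theorem isNPHard_cbiLanguage_four : IsNPHard (cbiLanguage 4) := fun L hL =>
  PolyTimeKarpReducible.trans_holds (ThreeDM.THREEDM_isNPHard_of Schaefer1978_oneInThreeSAT_NPHard_holds L hL)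
    THREEDM_karpReducible_cbiLanguage_four

end Reduction

end TDMCBI

end Literature.GroupTheory.CombinatorialGroupTheory

end
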